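import Literature.Probability.RandomPlanarGeometry.SLERestrictionHitScales
import Literature.Probability.RandomPlanarGeometry.RestrictionDerivMultiScale
import Literature.Probability.RandomPlanarGeometry.LoewnerUniformContinuity
import Literature.Analysis.Complex.ArcGreenCone
import HarnessLib

/-!
# [LSW] Lemma 6.3 assembled: `Φ'_{A_t}(W_t) → 0` from the hit-path facts

The analytic proof of [LSW] Lemma 6.3 (`IsSmoothHull.restrictionDerivVanishesAtHit`), modulo
the named facts on hit paths (`IsSmoothHull.hitPath_tendsto`, `IsSmoothHull.hitPath_stolz`,
`SLERestrictionHitPath`) and on access arcs (`IsSmoothHullWith.exists_smoothHitPath`,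
`IsArcHull.exists_accessArc`, `SLERestrictionHitPathAccess`):

* `exists_crossingArc` — at a time `t < T` at which `g_t - W_t` is uniformly close to
  `F = g_T - W_T` on the chain set, the slid image of `β[x_k, x_{k+1}]` contains a Jordan arc
  crossing the cone-annulus `{ρ_k/10 ≤ ‖w‖ ≤ ρ_k} ∩ {|re w| ≤ c' im w}` inside
  `(g_t(Γ_{x_{k+1}}) - W_t) ∖ (g_t(Γ_{x_k}) - W_t)`;
* `restrictionDeriv_slidHull_lt` — for `t < T` close to `T`, `Φ'_{g_t(A) - W_t}(0) < ε`
  (`restrictionDeriv_le_pow` along the slid chain sets, `LoewnerUniformContinuity`);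
* `restrictionDerivVanishesAtHit_of_facts` — **[LSW] Lemma 6.3** for smooth `*`-hulls, from the
  four named facts.
-/

noncomputable section

open Set Filter Metric Complex
open _root_.Topology
open UpperHalfPlane (upperHalfPlaneSet isOpen_upperHalfPlaneSet)
open Literature.Topology.PlaneTopology Literature.Analysis.Complex
open scoped NNReal unitInterval

namespace Literature.Probability.RandomPlanarGeometry

section Assembly

variable {W : ℝ≥0 → ℝ} {A Λ : Set ℂ} {β : ℝ → ℂ} {xb xs : ℝ} {τ : ℝ≥0}

/-- In a cone `|re z| ≤ c im z` (`0 < c`), `‖z‖ ≤ √(1+c²) im z`. [folklore] -/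
theorem norm_le_sqrt_mul_im {c : ℝ} (hc : 0 < c) {z : ℂ} (hz : |z.re| ≤ c * z.im) :
    ‖z‖ ≤ Real.sqrt (1 + c ^ 2) * z.im := by
  have h := im_ge_of_mem_cone (L := {z}) (r₁ := ‖z‖) (r₂ := ‖z‖) hc
    (fun w hw ↦ by rw [mem_singleton_iff.1 hw]; exact ⟨le_rfl, le_rfl, hz⟩) (mem_singleton z)
  have hs : 0 < Real.sqrt (1 + c ^ 2) := Real.sqrt_pos.2 (by positivity)
  rwa [div_le_iff₀ hs, mul_comm] at h

/-- **The crossing arc at time `t`.** Chain data, indices `x_k < x_{k+1}` in `(x_*, 1)` with the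
level properties of `exists_scaleSeq` for `ρ = m_k/(640 √(1+c'²))`, `c' = 2c₁`, the Stolz bound
`|re F(β y)| ≤ c₁ im F(β y)` (`c₁ ≥ 1`), and a time `t < T` at which
`‖(g_t - W_t) - (g_T - W_T)‖ ≤ ρ/(120 √(1+c₁²))` on `Γ_{x_{k+1}}`: then
`(g_t(Γ_{x_{k+1}}) - W_t) ∖ (g_t(Γ_{x_k}) - W_t)` contains a Jordan arc crossing the
cone-annulus `{ρ/10 ≤ ‖w‖ ≤ ρ} ∩ {|re w| ≤ c' im w}` from the outer to the inner circle.
[folklore] -/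
theorem IsChainData.exists_crossingArc (h : IsChainData A Λ β xb xs) (hW : Continuous W)
    (hA : IsArcHull A) (hτ : Loewner.IsHullHitTime W A τ)
    (hreal : ∀ x : ℝ, (x : ℂ) ∈ A → ¬ Loewner.swallowingTime W x ≤ (τ : WithTop ℝ≥0))
    {c₁ : ℝ} (hc₁ : 1 ≤ c₁)
    (hstolz : ∀ y ∈ Ico (0 : ℝ) 1, |(Loewner.map W τ (β y) - W τ).re| ≤ c₁ * (Loewner.map W τ (β y) - W τ).im)
    {xk xk1 : ℝ} (hxk : xs < xk) (hkk : xk < xk1) (hxk1 : xk1 < 1)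
    {m : ℝ} (hm : ∀ z ∈ Λ ∪ β '' Icc xs xk, m ≤ ‖Loewner.map W τ z - W τ‖)
    {ρ : ℝ} (hρ : 0 < ρ) (hρm : ρ = m / (640 * Real.sqrt (1 + (2 * c₁) ^ 2)))
    (hend : ‖Loewner.map W τ (β xk1) - W τ‖ ≤ ρ / 11)
    {t : ℝ≥0} (ht : t < τ)
    (herr : ∀ z ∈ Λ ∪ β '' Icc xs xk1,
      ‖(Loewner.map W t z - W t) - (Loewner.map W τ z - W τ)‖ ≤ ρ / (120 * Real.sqrt (1 + c₁ ^ 2))) :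
    ∃ (L : Set ℂ) (e : I ≃ₜ L),
      L ⊆ Loewner.slidHull W (Λ ∪ β '' Icc xs xk1) t \ Loewner.slidHull W (Λ ∪ β '' Icc xs xk) t ∧
      (∀ w ∈ L, ρ / 10 ≤ ‖w‖ ∧ ‖w‖ ≤ ρ ∧ |w.re| ≤ (2 * c₁) * w.im) ∧
      ‖((e 0 : L) : ℂ)‖ = ρ ∧ ‖((e 1 : L) : ℂ)‖ = ρ / 10 := by
  have hc₁pos : 0 < c₁ := by linarith
  have hs₁ : 1 ≤ Real.sqrt (1 + c₁ ^ 2) := Real.one_le_sqrt.2 (by nlinarith)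
  have hs₁pos : 0 < Real.sqrt (1 + c₁ ^ 2) := by linarith
  set err : ℝ := ρ / (120 * Real.sqrt (1 + c₁ ^ 2)) with herrdef
  have herr_le : err ≤ ρ / 120 := by
    rw [herrdef]; exact div_le_div_of_nonneg_left hρ.le (by norm_num) (by nlinarith)
  -- `m` is large compared to `ρ`
  have hs₂ : 1 ≤ Real.sqrt (1 + (2 * c₁) ^ 2) := Real.one_le_sqrt.2 (by nlinarith)
  have hmρ : 640 * ρ ≤ m := by
    have : m = ρ * (640 * Real.sqrt (1 + (2 * c₁) ^ 2)) := by
      rw [hρm]; field_simp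
    rw [this]; nlinarith
  -- all points of `β[0, 1]` and of the chain sets are flowing at time `t`
  have hTβ : ∀ y ∈ Icc (0 : ℝ) 1, (t : WithTop ℝ≥0) < Loewner.swallowingTime W (β y) := by
    intro y hy
    have h1 : (τ : WithTop ℝ≥0) ≤ Loewner.swallowingTime W (β y) := by
      rcases hy.2.eq_or_lt with h1 | h1
      · -- `β 1`: the limit point; `τ ≤ T` on `A ⊇ closure`… use `le_swallowingTime` on `A`
        have hmem : β 1 ∈ A := by
          have hcl : β 1 ∈ closure (β '' Ico 0 1) := by
            have hc := h.cont.continuousWithinAt (right_mem_Icc.2 zero_le_one)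
            haveI : (𝓝[Ico (0 : ℝ) 1] (1 : ℝ)).NeBot := by
              rw [← mem_closure_iff_nhdsWithin_neBot, closure_Ico zero_ne_one]
              exact ⟨zero_le_one, le_rfl⟩
            refine mem_closure_of_tendsto (hc.mono_left (nhdsWithin_mono _ Ico_subset_Icc_self)) ?_
            exact eventually_nhdsWithin_of_forall fun y hy ↦ (mem_image_of_mem β hy : β y ∈ β '' Ico 0 1)
          have hsub : β '' Ico (0 : ℝ) 1 ⊆ A := by
            rintro _ ⟨y, hy, rfl⟩; exact interior_subset (h.mem_int y hy)
          exact hA.isBoundedHull.isClosed.closure_subset_iff.2 hsub (h1 ▸ hcl)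
        rw [h1]
        exact hτ.le_swallowingTime hA.isBoundedHull.subset_closure hmem
      · exact le_of_lt (hτ.lt_swallowingTime_of_mem_interior hW hA hreal (h.mem_int y ⟨hy.1, h1⟩))
    exact lt_of_lt_of_le (WithTop.coe_lt_coe.2 ht) h1
  have hTchain : ∀ z ∈ Λ ∪ β '' Icc xs xk1, (t : WithTop ℝ≥0) < Loewner.swallowingTime W z := fun z hz ↦
    lt_trans (WithTop.coe_lt_coe.2 ht) (h.lt_swallowingTime_of_mem_chain hW hA hτ hreal hxk1 hz)
  -- the path `P = (g_t - W_t) ∘ β` on `[0, 1]`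
  set P : ℝ → ℂ := fun y ↦ Loewner.map W t (β y) - W t with hP
  have hPc : ContinuousOn P (Icc 0 1) :=
    (Loewner.continuousOn_map_sub_driving hW (by rintro _ ⟨y, hy, rfl⟩; exact hTβ y hy)).comp h.cont
      (mapsTo_image _ _)
  have hPi : InjOn P (Icc 0 1) := by
    intro y₁ hy₁ y₂ hy₂ heq
    have heq' : Loewner.map W t (β y₁) = Loewner.map W t (β y₂) := sub_left_injective heq
    exact h.inj hy₁ hy₂ (Loewner.injOn_map_of_lt_swallowingTime hW t (hTβ y₁ hy₁) (hTβ y₂ hy₂) heq')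
  have hxk0 : 0 ≤ xk := h.xs_mem.1.trans hxk.le
  obtain ⟨e₀, he₀0, he₀1⟩ := (isSimpleArc_image_Icc hPc hPi hxk0 hkk hxk1.le).exists_homeomorph
  -- endpoint norms at time `t`
  have hβmem : ∀ y ∈ Icc xk xk1, β y ∈ Λ ∪ β '' Icc xs xk1 := fun y hy ↦
    Or.inr ⟨y, ⟨hxk.le.trans hy.1, hy.2⟩, rfl⟩
  have hclose : ∀ y ∈ Icc xk xk1, ‖P y - (Loewner.map W τ (β y) - W τ)‖ ≤ err := fun y hy ↦
    herr _ (hβmem y hy)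
  have hstart : ρ ≤ ‖((e₀ 0 : P '' Icc xk xk1) : ℂ)‖ := by
    rw [he₀0]
    have h1 := hm (β xk) (Or.inr ⟨xk, ⟨hxk.le, le_rfl⟩, rfl⟩)
    have h2 := hclose xk ⟨le_rfl, hkk.le⟩
    have h3 := norm_sub_norm_le (Loewner.map W τ (β xk) - W τ) (P xk)
    rw [norm_sub_rev] at h2
    linarith
  have hfinish : ‖((e₀ 1 : P '' Icc xk xk1) : ℂ)‖ ≤ ρ / 10 := by
    rw [he₀1]
    have h2 := hclose xk1 ⟨hkk.le, le_rfl⟩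
    have h3 := norm_sub_norm_le (P xk1) (Loewner.map W τ (β xk1) - W τ)
    linarith
  obtain ⟨L, e, hLsub, he0, he1, hann⟩ := exists_subarc_crossing e₀ (r₁ := ρ / 10) (r₂ := ρ)
    (by linarith) hstart hfinish
  refine ⟨L, e, fun w hw ↦ ?_, fun w hw ↦ ?_, he0, he1⟩
  · -- `L ⊆ A_{k+1}(t) ∖ A_k(t)`
    obtain ⟨y, hy, rfl⟩ := hLsub hw
    refine ⟨⟨β y, hβmem y hy, rfl⟩, ?_⟩
    rintro ⟨z, hz, hzw⟩
    -- `z ∈ Γ_{x_k}` with the same image as `β y`: then `z = β y`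
    have hzT := hTchain z (IsChainData.chain_mono (Λ := Λ) (β := β) (xs := xs) hkk.le hz)
    have hyT := hTβ y ⟨hxk0.trans hy.1, hy.2.trans hxk1.le⟩
    have hzeq : z = β y :=
      Loewner.injOn_map_of_lt_swallowingTime hW t hzT hyT (sub_left_injective hzw)
    rcases hz with hzΛ | ⟨y', hy', hy'e⟩
    · -- `β y ∈ Λ ∩ β[x_*, 1] ⊆ {β x_*}`, so `y = x_*`, absurd
      have : β y ∈ Λ ∩ β '' Icc xs 1 :=
        ⟨hzeq ▸ hzΛ, ⟨y, ⟨hxk.le.trans hy.1, hy.2.trans hxk1.le⟩, rfl⟩⟩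
      have hyxs := h.meet this
      rw [mem_singleton_iff] at hyxs
      have := h.inj ⟨hxk0.trans hy.1, hy.2.trans hxk1.le⟩ ⟨h.xs_mem.1, h.xs_mem.2.le⟩ hyxs
      linarith [hy.1]
    · -- `β y = β y'` with `y' ≤ x_k ≤ y`: `y = x_k`, but then `‖w‖ ≥ m - err > ρ`
      have hyy' : y' = y := h.inj ⟨h.xs_mem.1.trans hy'.1, hy'.2.trans (hkk.le.trans hxk1.le)⟩
        ⟨hxk0.trans hy.1, hy.2.trans hxk1.le⟩ (hy'e.trans hzeq)
      have hyk : y = xk := le_antisymm (hyy' ▸ hy'.2) hy.1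
      have h1 := (hann _ hw).2
      have h2 := hm (β xk) (Or.inr ⟨xk, ⟨hxk.le, le_rfl⟩, rfl⟩)
      have h3 := hclose xk ⟨le_rfl, hkk.le⟩
      have h4 := norm_sub_norm_le (Loewner.map W τ (β xk) - W τ) (P xk)
      rw [norm_sub_rev] at h3
      rw [hyk] at h1
      change ‖P xk‖ ≤ ρ at h1
      linarith
  · -- the cone-annulus conditions
    obtain ⟨h1, h2⟩ := hann w hw
    refine ⟨h1, h2, ?_⟩
    obtain ⟨y, hy, rfl⟩ := hLsub hw
    have hy1 : y < 1 := lt_of_le_of_lt hy.2 hxk1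
    have hst := hstolz y ⟨hxk0.trans hy.1, hy1⟩
    set Fz : ℂ := Loewner.map W τ (β y) - W τ with hFz
    have hcl := hclose y hy
    have hre : |(P y).re - Fz.re| ≤ err := by
      rw [← Complex.sub_re]; exact (Complex.abs_re_le_norm _).trans hcl
    have him : |(P y).im - Fz.im| ≤ err := by
      rw [← Complex.sub_im]; exact (Complex.abs_im_le_norm _).trans hcl
    have hFnorm : ρ / 20 ≤ ‖Fz‖ := by
      have := norm_sub_norm_le (P y) Fz
      change ρ / 10 ≤ ‖P y‖ at h1
      linarith
    have hFim : ρ / (20 * Real.sqrt (1 + c₁ ^ 2)) ≤ Fz.im := by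
      have h3 := norm_le_sqrt_mul_im hc₁pos hst
      rw [div_le_iff₀ (by positivity)]
      nlinarith
    have hwim : ρ / (24 * Real.sqrt (1 + c₁ ^ 2)) ≤ (P y).im := by
      have h3 := (abs_le.1 him).1
      have : ρ / (24 * Real.sqrt (1 + c₁ ^ 2)) = ρ / (20 * Real.sqrt (1 + c₁ ^ 2)) - ρ / (120 * Real.sqrt (1 + c₁ ^ 2)) := by
        field_simp; ring
      rw [this]; rw [herrdef] at h3; linarith
    have hre' : |(P y).re| ≤ c₁ * Fz.im + err := by
      have h3 := abs_le.1 hre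
      have h4 := abs_le.1 hst
      rw [abs_le]; constructor <;> linarith
    have hFim' : Fz.im ≤ (P y).im + err := by linarith [(abs_le.1 him).1]
    have herr_im : err ≤ (P y).im * (24 / 120) := by
      rw [herrdef]
      have : ρ / (120 * Real.sqrt (1 + c₁ ^ 2)) = ρ / (24 * Real.sqrt (1 + c₁ ^ 2)) * (24 / 120) := by
        field_simp
      rw [this]; gcongr
    have hPim_nonneg : 0 ≤ (P y).im := le_trans (by positivity) hwim
    calc |(P y).re| ≤ c₁ * Fz.im + err := hre'
      _ ≤ c₁ * ((P y).im + err) + err := by gcongr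
      _ = c₁ * (P y).im + (c₁ + 1) * err := by ring
      _ ≤ c₁ * (P y).im + (2 * c₁) * ((P y).im * (24 / 120)) := by
          gcongr
          · linarith
      _ ≤ 2 * c₁ * (P y).im := by nlinarith

end Assembly

end Literature.Probability.RandomPlanarGeometry
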